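/-
Copyright (c) 2026 the pub-hodgecm-mathlib formalisation cell (harness21).  Prover seat hodgecm-mathlib-K2E3-p31 (g3), HCML Track B, programme R90-TF
(Rogawski 1990 trace formula), section S4 = Ch. 13.1–2, base `R90-C131`; S4 dealer K2E2-plan (g8), ruling S4-R59 (2) 2026-09-05T03:04:50Z:
«(J̃♭-Σ) ASSEMBLER OF RECORD» — the ONE (J̃♭) socket `stub_R90_S4_twistedTubeJacobian` of S4 FILE C ED. 6 paid from its rows; Σ-1 of 2.  2026-09-05.
-/
import Summits.HodgeConjecture.HodgeConjecture.Theorems.R90S4TwistedTubeTransversal     -- ★ (B1-T) part 1 (R90-C131-p03): `epsNorm_sheet`, `injective_sheet`; brings ★ `R90S4CartanMeasures` (`Gqs`, `cartanWeight`), ★ `R90S4CartanNormMap`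
import Summits.HodgeConjecture.HodgeConjecture.Theorems.R90S4TwistedNormMapLocal        -- ★ C-NORM local (K2E3-p27): `epsLoc_eq_self_iff_mem_local`
import Summits.HodgeConjecture.HodgeConjecture.Theorems.R90S4EpsOrbitalCanonical        -- ★ S4#C-CAN: `continuous_epsLoc`, `isClosed_epsCentralizer`; brings ★ `IsEpsRegularAt`, ★ `compactCore`
import Summits.HodgeConjecture.HodgeConjecture.Theorems.R90S4SplitFormHermitian         -- ★ `splitFormGL_isHermitian`
import Summits.HodgeConjecture.HodgeConjecture.Theorems.R90S4EpsCentralizerMeasureTransport  -- ★ B3-2 (R90-C131-p03): `haar_map_eq_of_apply_compactCore_eq_one` (the pin transport)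
import Summits.HodgeConjecture.HodgeConjecture.Theorems.R90S4TwistedTubeJacobianCore      -- ★ p864907 (TJ5-abs, K2E3-p03): `twistedTubeJacobian_of_local` (THE ONE CALL); brings ★ p864668 Sweep, ★ p864860 SweepMeasure
import Literature.MeasureTheory.Group.InvariantQuotientExistence                         -- ★ (Q0) `quotientMeasure`
import HarnessLib

/-!
# R90-TF · S4 «Ch. 13.1–2» · road (J̃♭) — THE TWISTED TUBE JACOBIAN LETTER FROM ITS ROWS (Σ-1 of 2: the ★ (TJ5-abs) call at the datum + sheet glue)

Cell `hodgecm-mathlib`, crux H413 (`stmt-HodgeConjecture-24833`, lane `--supports … --as helper`), route of record `HCCMUnconditional` (no route verbs;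
count-neutral).  THEOREMS ONLY (no `def`, no `instance`, no notation, no named-fact hypothesis, no `sorry`); ★-only imports, NO `Lines` import.

THE SOCKET (typ1 (g2) `ED6_probe.v3.lean` :85–:118 with `hTc` dropped = the v3.1 ONE socket `stub_R90_S4_twistedTubeJacobian`, S4-R59 (1); `GLoc L v` spelled
`Gqs L v`, rfl-equal): for a Cartan `T = Cent_{G_v}(γ₀)` (`γ₀` regular), `T̃ = Cent_{G̃_v}(γ₀)`, an ε-regular `δ₀ ∈ T̃` with ε-centraliser `T′` and core-one Haar `τ′`,
the twisted family `Ψ(xT′, b) = x b ε(x)⁻¹`, a Borel norm section `s : T → T̃` (`N ∘ s = ι`), a norm-one sheet transversal `R`, and the core-one Haar `tT` of `T`: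
every point `b₁` of the sheeted transversal `B₀ = ⋃_{u ∈ R} s(T^{reg})·u` has a `T̃`-window `U′ ∋ b₁` and a Borel `A₀ ⊆ G̃_v ⧸ T′` of positive finite
`μ₀ = νGt ∕ τ′`-measure with `νGt(Ψ(A₀ × s(V)·u)) = μ₀(A₀) · ∫⁻_V D_T dt_T` for every sheet `u ∈ R` and Borel `V ⊆ T^{reg}` whose sheet image lies in `U′` —
«`dδ̃ = D_G(Nδ)² dδ` on the twisted tube» [Rogawski1990, §12.5 p. 186; §4.10 pp. 62–64].

THE ASSEMBLY (S4-R59 (2), the (DICT-Σ) pattern): ONE call of K2E3-p03 (g10)'s (TJ5-abs) `twistedTubeJacobian_of_local` INSTANTIATED AT THE DATUM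
(`G := G̃_v`, `A := T̃`, `P′ := T′`, `P := T`, `φ := N`, `D_P := cartanWeight`, `tP := tT`) fed the rows [H-loc] (MODEL, `R90S4TwistedTubeModel`), (TJ5-win),
[H-♮] ((TJ6) HERBRAND WINDOW, `R90S4TwistedHerbrandWindow`), then THIS FILE's SHEET GLUE from the `∀ B ⊆ U′ Borel, InjOn N B` clause to the socket's
`∀ u ∈ R, ∀ V ⊆ T^{reg}` clause (`B := s(V)·u`, `N(s t · u) = t`).
* §1 **`exists_epsNormHom`** — THE NORM HOMOMORPHISM `N : T̃ →* T` as an ∃-theorem (continuous, onto, `(N b).val = b ε(b)`): values in `G_v` by ★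
  `epsLoc_epsNorm_of_mem_centralizer` + ★ `epsLoc_eq_self_iff_mem_local`, in `Cent(γ₀)` by ★ `epsNorm_mem_centralizer_coe`, multiplicative by ★
  `epsNorm_mul_of_mem_centralizer`, continuous by ★ `continuous_epsLoc`, onto by ★ `exists_mem_centralizer_epsNorm_eq` [§3.11 Prop. 3.11.1 (a)];
  **`exists_pinEquiv_map_eq`**, **`exists_herbrandPin`** — THE PIN `e : T ≃ T′` (★ B3-1) carrying the core-one Haar `tT` to `τ′` (★ B3-2
  `haar_map_eq_of_apply_compactCore_eq_one`), in ★ FILE 3b∕3d's `(e, he, hφe, hpin)` shape; **`exists_haar_of_comm`** — right- and inversion-invariant Haar measures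
  on the abelian `T̃`, `T̃ᴺ` (their normalisations CANCEL in ★ (TJ5-abs)).
* §2 **SHEET GLUE**: `measurableSet_sheet_image` (Lusin–Souslin on the standard Borel `T`, as ★ `measurableSet_sheetTransversal`), `apply_sheet_eq` (`N(s t·u) = t` read
  through any norm homomorphism), `sheet_clause_of_injOn_clause` (the `B`-clause ⇒ the `(u, V)`-clause, for an arbitrary set functional).
* §3 **`twistedTubeJacobian_of_rows`** — THE LETTER at every base point FROM THE PER-BASE-POINT ROW BUNDLE `HB` (the rows `W hWo hWc hWanti hWb hWε` ∕
  `hA₀m hν hwin₁ hwin₂` (★ p864964) ∕ `hUloc hD hloc` (★ p865097 MODEL at the datum) ∕ `hnat` (★ p865254) in ★ p864907's bytes): ONE call of ★ p864907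
  `twistedTubeJacobian_of_local` with every FRAME letter discharged here, then §2.  The sibling Σ-2 `R90S4TwistedTubeJacobianOfRecord` builds `HB` from the
  ★ rows BY NAME and states the socket bytes (`twistedTubeJacobian_of_record`).
HONEST LABEL: HC_CM is proved only modulo the 7 printed citations (2 remaining named inputs: hLiu418 = `stmt-HodgeConjecture-24832`, h413 =
`stmt-HodgeConjecture-24833`) until rung 0 closes.  This file pays no socket by itself (Σ-2 does, once every row is ★); (J̃♭) ∕ (W-NP) stay OPEN; REL ≠ ★ ≠ BUILT.

## References
* [Rogawski1990] J. D. Rogawski, *Automorphic Representations of Unitary Groups in Three Variables*, Ann. of Math. Stud. 123 (1990), §12.5 p. 186; §4.10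
  pp. 62–64; §3.11 Prop. 3.11.1 pp. 34–35.
* [HarishChandra1970] Harish-Chandra (notes by G. van Dijk), *Harmonic Analysis on Reductive p-adic Groups*, LNM 162 (1970), Lemma 22. Context locator.
* [Kechris1995] A. S. Kechris, *Classical Descriptive Set Theory*, GTM 156 (1995), Thm. 15.1 (Lusin–Souslin). Context locator.
* [DeitmarEchterhoff2014] A. Deitmar, S. Echterhoff, *Principles of Harmonic Analysis*, 2nd ed. (2014), Thm. 1.5.3. Context locator.
-/

set_option autoImplicit false
-- the mandated namespace repeats the single-problem summit's segment (`HodgeConjecture.HodgeConjecture`)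
set_option linter.dupNamespace false

noncomputable section

open MeasureTheory Measure Set Filter Topology Function NumberField IsDedekindDomain
open scoped ENNReal NNReal MatrixGroups Pointwise
open Literature.MeasureTheory.Group
open Literature.NumberTheory.Rogawski1990 Literature.NumberTheory.Rogawski1990.Ch4Sec10
open Literature.NumberTheory.Automorphic Literature.NumberTheory.Automorphic.UnitaryGroup

namespace Summit.HodgeConjecture.HodgeConjecture.R90.S4

section JacobianOfRows

variable {L : Type} [Field L] [NumberField L] [IsCMField L] {v : HeightOneSpectrum (𝓞 ↥(maximalRealSubfield L))}

/-! ## §1 The norm homomorphism `N : T̃ →* T` -/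

/-- **THE NORM HOMOMORPHISM `N : T̃ = Cent_{G̃_v}(γ₀) →* T = Cent_{G_v}(γ₀)`** (`γ₀` regular), as an existence statement: a continuous SURJECTIVE group
homomorphism `φ` with `(φ b).val = N b = b ε_v(b)` for every `b ∈ T̃` — `N b` is `ε_v`-fixed (★ `epsLoc_epsNorm_of_mem_centralizer`) hence in `G_v` (★
`epsLoc_eq_self_iff_mem_local`), commutes with `γ₀` (★ `epsNorm_mem_centralizer_coe`), `N` is multiplicative on the abelian `T̃` (★ `epsNorm_mul_of_mem_centralizer`),
continuous (★ `continuous_epsLoc`) and onto `T` (★ `exists_mem_centralizer_epsNorm_eq`: «`1 → Z̃T̃ᴺ → T̃ —N→ T → 1`»).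
[cite: Rogawski1990, §3.11 Prop. 3.11.1 (a) pp. 34–35; §12.5 p. 186] -/
theorem exists_epsNormHom {T : Subgroup (Gqs L v)} {γ₀ : Gqs L v} (hγ₀ : IsRegularElt (γ₀.val : GtLoc L v))
    (hT : T = Subgroup.centralizer ({γ₀} : Set (Gqs L v))) :
    ∃ φ : ↥(Subgroup.centralizer ({(γ₀.val : GtLoc L v)} : Set (GtLoc L v))) →* ↥T,
      Continuous φ ∧ Function.Surjective φ ∧
        ∀ b : ↥(Subgroup.centralizer ({(γ₀.val : GtLoc L v)} : Set (GtLoc L v))),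
          (((φ b : ↥T) : Gqs L v).val : GtLoc L v) = epsNorm (epsLoc L (splitFormGL L) v) (b : GtLoc L v) := by
  have hΦ := splitFormGL_isHermitian L
  -- `N b ∈ G_v`
  have hU : ∀ b : ↥(Subgroup.centralizer ({(γ₀.val : GtLoc L v)} : Set (GtLoc L v))),
      epsNorm (epsLoc L (splitFormGL L) v) (b : GtLoc L v) ∈ «local» L (IsCMField.complexConj L) 3 ((splitFormGL L : GL (Fin 3) L) : Matrix (Fin 3) (Fin 3) L) v :=
    fun b => (epsLoc_eq_self_iff_mem_local L (splitFormGL L) v _).1 (epsLoc_epsNorm_of_mem_centralizer hΦ hγ₀ b.2)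
  -- `N b ∈ T`
  have hmem : ∀ b : ↥(Subgroup.centralizer ({(γ₀.val : GtLoc L v)} : Set (GtLoc L v))),
      (⟨epsNorm (epsLoc L (splitFormGL L) v) (b : GtLoc L v), hU b⟩ : Gqs L v) ∈ T := fun b => by
    rw [hT]
    exact (coe_mem_centralizer_coe_iff (Φ := splitFormGL L) γ₀ _).1 (epsNorm_mem_centralizer_coe (Φ := splitFormGL L) γ₀ b.2)
  let φ : ↥(Subgroup.centralizer ({(γ₀.val : GtLoc L v)} : Set (GtLoc L v))) →* ↥T :=
    { toFun := fun b => ⟨⟨epsNorm (epsLoc L (splitFormGL L) v) (b : GtLoc L v), hU b⟩, hmem b⟩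
      map_one' := by
        refine Subtype.ext (Subtype.ext ?_)
        show epsNorm (epsLoc L (splitFormGL L) v) (1 : GtLoc L v) = 1
        simp [epsNorm]
      map_mul' := fun a b => Subtype.ext (Subtype.ext (by
        show epsNorm (epsLoc L (splitFormGL L) v) ((a : GtLoc L v) * (b : GtLoc L v)) =
          epsNorm (epsLoc L (splitFormGL L) v) (a : GtLoc L v) * epsNorm (epsLoc L (splitFormGL L) v) (b : GtLoc L v)
        exact epsNorm_mul_of_mem_centralizer (Φ := splitFormGL L) hγ₀ a.2 b.2)) }
  refine ⟨φ, ?_, ?_, fun _ => rfl⟩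
  · -- continuity: `b ↦ b · ε_v(b)` is continuous on `G̃_v`, and `T ≤ G_v ≤ G̃_v` carry the induced topologies
    have hc : Continuous fun b : ↥(Subgroup.centralizer ({(γ₀.val : GtLoc L v)} : Set (GtLoc L v))) =>
        epsNorm (epsLoc L (splitFormGL L) v) (b : GtLoc L v) :=
      continuous_subtype_val.mul ((continuous_epsLoc L (splitFormGL L) v).comp continuous_subtype_val)
    exact (hc.subtype_mk fun b => hU b).subtype_mk fun b => hmem b
  · -- surjectivity: Prop. 3.11.1 (a)
    intro t
    have ht : (t : Gqs L v) ∈ Subgroup.centralizer ({γ₀} : Set (Gqs L v)) := hT ▸ t.2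
    obtain ⟨δ, hδ, hN⟩ := exists_mem_centralizer_epsNorm_eq L (splitFormGL L) v γ₀ ht
    exact ⟨⟨δ, hδ⟩, Subtype.ext (Subtype.ext hN)⟩

/-- **THE PIN (P): `T ≃ₜ* T′ = G̃_{δ₀ε}` BY THE IDENTITY ON `G̃_v`, CARRYING THE CORE-ONE HAAR MEASURE `tT` TO `τ′`.**  For `δ₀ ∈ T̃` ε-regular the ε-centraliser
`T′ = G̃_{δ₀ε}` IS `T` (★ B3-1 `exists_continuousMulEquiv_epsCentralizer_of_mem_centralizer`: `e`, `(e t) = t.val`), and compact-core-normalised Haar measures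
correspond under any isomorphism of topological groups (★ `haar_map_eq_of_apply_compactCore_eq_one`), so `e_* tT = τ′` — the three Haar normalisations of the
letter (`tT`, `τ′`, and `N`) are tied: `(e (φ w)) = N w`. [cite: Rogawski1990, §12.5 p. 186; §3.11 Prop. 3.11.2 pp. 34–35; §4.3 (4.3.1) p. 43] -/
theorem exists_pinEquiv_map_eq [LocallyCompactSpace (GtLoc L v)] [SecondCountableTopology (GtLoc L v)] [T2Space (GtLoc L v)]
    [MeasurableSpace (Gqs L v)] [BorelSpace (Gqs L v)] [MeasurableSpace (GtLoc L v)] [BorelSpace (GtLoc L v)]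
    {T : Subgroup (Gqs L v)} {γ₀ : Gqs L v} (hγ₀ : IsRegularElt (γ₀.val : GtLoc L v)) (hT : T = Subgroup.centralizer ({γ₀} : Set (Gqs L v)))
    {δ₀ : GtLoc L v} (hδ₀T : δ₀ ∈ Subgroup.centralizer ({(γ₀.val : GtLoc L v)} : Set (GtLoc L v))) (hδ₀reg : IsEpsRegularAt L (splitFormGL L) v δ₀)
    (τ' : Measure ↥(epsCentralizer (epsLoc L (splitFormGL L) v) δ₀)) [τ'.IsHaarMeasure]
    (h1 : τ' (compactCore ↥(epsCentralizer (epsLoc L (splitFormGL L) v) δ₀)) = 1)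
    (tT : Measure ↥T) [tT.IsHaarMeasure] (htc : tT (compactCore ↥T) = 1) :
    ∃ e : ↥T ≃ₜ* ↥(epsCentralizer (epsLoc L (splitFormGL L) v) δ₀),
      (∀ t : ↥T, ((e t : ↥(epsCentralizer (epsLoc L (splitFormGL L) v) δ₀)) : GtLoc L v) = ((t : Gqs L v)).val) ∧ Measure.map e tT = τ' := by
  have hΦ := splitFormGL_isHermitian L
  subst hT
  obtain ⟨e₀, he₀⟩ := exists_continuousMulEquiv_epsCentralizer_of_mem_centralizer hΦ hγ₀ hδ₀T hδ₀reg
  haveI : LocallyCompactSpace ↥(epsCentralizer (epsLoc L (splitFormGL L) v) δ₀) := (isClosed_epsCentralizer L (splitFormGL L) v δ₀).locallyCompactSpace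
  refine ⟨e₀.symm, fun t => ?_, haar_map_eq_of_apply_compactCore_eq_one e₀.symm tT τ' htc h1⟩
  have h := he₀ (e₀.symm t)
  rw [e₀.apply_symm_apply] at h
  exact h.symm

/-- **THE PIN IN ★ FILE 3b's SHAPE** (`herbrandWindow_of_index`'s `(e, he, hφe, hpin)`): for the socket's core-one Haar measures `τ′` on `T′ = G̃_{δ₀ε}` and `tT` on
`T`, and ANY norm homomorphism `φ` (`(φ w).val = N w`), a group isomorphism `e : T ≃* T′`, continuous, with `e (φ w) = N w = w ε(w)` in `G̃_v` and `e_* tT = τ′`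
(`exists_pinEquiv_map_eq`).  This is the «`τ′ = ι_* tT`» under which alone the Herbrand window identity (♮) is scale-consistent (K2E3-p03 (g10) 03:03:30Z; K2E3-p36 (g4)).
[cite: Rogawski1990, §12.5 p. 186; §4.3 (4.3.1) p. 43] -/
theorem exists_herbrandPin [LocallyCompactSpace (GtLoc L v)] [SecondCountableTopology (GtLoc L v)] [T2Space (GtLoc L v)]
    [MeasurableSpace (Gqs L v)] [BorelSpace (Gqs L v)] [MeasurableSpace (GtLoc L v)] [BorelSpace (GtLoc L v)]
    {T : Subgroup (Gqs L v)} {γ₀ : Gqs L v} (hγ₀ : IsRegularElt (γ₀.val : GtLoc L v)) (hT : T = Subgroup.centralizer ({γ₀} : Set (Gqs L v)))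
    {δ₀ : GtLoc L v} (hδ₀T : δ₀ ∈ Subgroup.centralizer ({(γ₀.val : GtLoc L v)} : Set (GtLoc L v))) (hδ₀reg : IsEpsRegularAt L (splitFormGL L) v δ₀)
    (τ' : Measure ↥(epsCentralizer (epsLoc L (splitFormGL L) v) δ₀)) [τ'.IsHaarMeasure]
    (h1 : τ' (compactCore ↥(epsCentralizer (epsLoc L (splitFormGL L) v) δ₀)) = 1)
    (tT : Measure ↥T) [tT.IsHaarMeasure] (htc : tT (compactCore ↥T) = 1)
    (φ : ↥(Subgroup.centralizer ({(γ₀.val : GtLoc L v)} : Set (GtLoc L v))) →* ↥T)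
    (hφ : ∀ b : ↥(Subgroup.centralizer ({(γ₀.val : GtLoc L v)} : Set (GtLoc L v))),
      (((φ b : ↥T) : Gqs L v).val : GtLoc L v) = epsNorm (epsLoc L (splitFormGL L) v) (b : GtLoc L v)) :
    ∃ e : ↥T ≃* ↥(epsCentralizer (epsLoc L (splitFormGL L) v) δ₀), Continuous e ∧
      (∀ w : ↥(Subgroup.centralizer ({(γ₀.val : GtLoc L v)} : Set (GtLoc L v))),
        ((e (φ w) : ↥(epsCentralizer (epsLoc L (splitFormGL L) v) δ₀)) : GtLoc L v) = (w : GtLoc L v) * epsLoc L (splitFormGL L) v w) ∧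
      Measure.map e tT = τ' := by
  obtain ⟨e₀, he₀, hmap⟩ := exists_pinEquiv_map_eq hγ₀ hT hδ₀T hδ₀reg τ' h1 tT htc
  refine ⟨e₀.toMulEquiv, e₀.continuous, fun w => ?_, hmap⟩
  show ((e₀ (φ w) : ↥(epsCentralizer (epsLoc L (splitFormGL L) v) δ₀)) : GtLoc L v) = _
  rw [he₀, hφ]
  rfl

/-- **A commutative locally compact group carries a Haar measure that is right- and inversion-invariant** (any Haar measure is, by commutativity; Mathlib's
instances for `CommGroup`, invoked on a local commutative structure).  Used for `τ̃` on the abelian `T̃` and `ρ` on `T̃ᴺ`, whose normalisations CANCEL in ★ p864907.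
[cite: DeitmarEchterhoff2014, Thm. 1.5.3] -/
theorem exists_haar_of_comm {H : Type*} [Group H] [TopologicalSpace H] [IsTopologicalGroup H] [LocallyCompactSpace H] [SecondCountableTopology H]
    [T2Space H] [MeasurableSpace H] [BorelSpace H] (hc : ∀ x y : H, x * y = y * x) :
    ∃ μ : Measure H, μ.IsHaarMeasure ∧ μ.IsMulRightInvariant ∧ μ.IsInvInvariant := by
  letI : CommGroup H := { ‹Group H› with mul_comm := hc }
  exact ⟨haar, inferInstance, inferInstance, inferInstance⟩

/-! ## §2 Sheet glue: from the `B`-clause to the `(u, V)`-clause -/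

/-- **A sheet image `s(V)·u` of a Borel `V ⊆ T` is Borel in `T̃`** (`T` is standard Borel: a closed subgroup of the lcsc Hausdorff `U(Φ₃)(L⁺_v)`; the sheet map
`t ↦ s(t) u` is Borel and injective, ★ `injective_sheet`; Lusin–Souslin — exactly as ★ `measurableSet_sheetTransversal`).
[cite: Kechris1995, Thm. 15.1] [cite: Rogawski1990, §12.5 p. 186] -/
theorem measurableSet_sheet_image [MeasurableSpace (Gqs L v)] [BorelSpace (Gqs L v)] [MeasurableSpace (GtLoc L v)] [BorelSpace (GtLoc L v)]
    [SecondCountableTopology (GtLoc L v)]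
    {T : Subgroup (Gqs L v)} {γ₀ : Gqs L v} (hγ₀ : IsRegularElt (γ₀.val : GtLoc L v)) (hT : T = Subgroup.centralizer ({γ₀} : Set (Gqs L v)))
    (s : ↥T → ↥(Subgroup.centralizer ({(γ₀.val : GtLoc L v)} : Set (GtLoc L v)))) (hsm : Measurable s)
    (hsN : ∀ t : ↥T, epsNorm (epsLoc L (splitFormGL L) v) (s t : GtLoc L v) = ((t : Gqs L v)).val)
    (R : Finset ↥(Subgroup.centralizer ({(γ₀.val : GtLoc L v)} : Set (GtLoc L v))))
    (hRN : ∀ u ∈ R, epsNorm (epsLoc L (splitFormGL L) v) (u : GtLoc L v) = 1)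
    {u : ↥(Subgroup.centralizer ({(γ₀.val : GtLoc L v)} : Set (GtLoc L v)))} (hu : u ∈ R) {V : Set ↥T} (hV : MeasurableSet V) :
    MeasurableSet ((fun t : ↥T => s t * u) '' V) := by
  classical
  haveI : LocallyCompactSpace (Gqs L v) :=
    locallyCompactSpace_cmDatum_local (L := L) (N := 3) (H := (splitFormGL L : Matrix (Fin 3) (Fin 3) L)) (v := v)
  haveI : SecondCountableTopology (Gqs L v) := TopologicalSpace.Subtype.secondCountableTopology _
  haveI : PolishSpace (Gqs L v) := Literature.Topology.Metrizable.polishSpace_of_locallyCompactSpace_of_secondCountableTopology _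
  have hTcl : IsClosed (T : Set (Gqs L v)) := by
    rw [hT]; exact Set.isClosed_centralizer _
  haveI : PolishSpace ↥T := hTcl.polishSpace
  exact hV.image_of_measurable_injOn (hsm.mul_const u) (injective_sheet hγ₀ s hsN R hRN u hu).injOn

/-- **A norm homomorphism recovers the parameter of a sheet point: `φ(s(t)·u) = t`** (`(φ b).val = N b`, ★ `epsNorm_sheet`: `N(s t · u) = t`).
[cite: Rogawski1990, §12.5 p. 186] -/
theorem apply_sheet_eq {T : Subgroup (Gqs L v)} {γ₀ : Gqs L v} (hγ₀ : IsRegularElt (γ₀.val : GtLoc L v))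
    (s : ↥T → ↥(Subgroup.centralizer ({(γ₀.val : GtLoc L v)} : Set (GtLoc L v))))
    (hsN : ∀ t : ↥T, epsNorm (epsLoc L (splitFormGL L) v) (s t : GtLoc L v) = ((t : Gqs L v)).val)
    (R : Finset ↥(Subgroup.centralizer ({(γ₀.val : GtLoc L v)} : Set (GtLoc L v))))
    (hRN : ∀ u ∈ R, epsNorm (epsLoc L (splitFormGL L) v) (u : GtLoc L v) = 1)
    (φ : ↥(Subgroup.centralizer ({(γ₀.val : GtLoc L v)} : Set (GtLoc L v))) →* ↥T)
    (hφ : ∀ b : ↥(Subgroup.centralizer ({(γ₀.val : GtLoc L v)} : Set (GtLoc L v))),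
      (((φ b : ↥T) : Gqs L v).val : GtLoc L v) = epsNorm (epsLoc L (splitFormGL L) v) (b : GtLoc L v))
    (t : ↥T) {u : ↥(Subgroup.centralizer ({(γ₀.val : GtLoc L v)} : Set (GtLoc L v)))} (hu : u ∈ R) :
    φ (s t * u) = t :=
  Subtype.ext (Subtype.ext (by rw [hφ, epsNorm_sheet hγ₀ s hsN R hRN t u hu]))

/-- **SHEET GLUE** — for a norm homomorphism `φ` and ANY set functional `F` on `T̃`: if `F B = c · ∫⁻_{φ(B)} f dtT` for every Borel `B ⊆ U′` on which `φ` is injective,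
then `F(s(V)·u) = c · ∫⁻_V f dtT` for every sheet `u ∈ R` and every Borel `V ⊆ T` with `s(V)·u ⊆ U′` (`φ ∘ (s·u) = id`, so `φ` is injective on the sheet image and
`φ(s(V)·u) = V`; the sheet image is Borel, `measurableSet_sheet_image`).  At the datum `F B = νGt(Ψ(A₀ × B))`, `c = μ₀(A₀)`, `f = cartanWeight`.
[cite: Rogawski1990, §12.5 p. 186] -/
theorem sheet_clause_of_injOn_clause [MeasurableSpace (Gqs L v)] [BorelSpace (Gqs L v)] [MeasurableSpace (GtLoc L v)] [BorelSpace (GtLoc L v)]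
    [SecondCountableTopology (GtLoc L v)]
    {T : Subgroup (Gqs L v)} {γ₀ : Gqs L v} (hγ₀ : IsRegularElt (γ₀.val : GtLoc L v)) (hT : T = Subgroup.centralizer ({γ₀} : Set (Gqs L v)))
    (s : ↥T → ↥(Subgroup.centralizer ({(γ₀.val : GtLoc L v)} : Set (GtLoc L v)))) (hsm : Measurable s)
    (hsN : ∀ t : ↥T, epsNorm (epsLoc L (splitFormGL L) v) (s t : GtLoc L v) = ((t : Gqs L v)).val)
    (R : Finset ↥(Subgroup.centralizer ({(γ₀.val : GtLoc L v)} : Set (GtLoc L v))))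
    (hRN : ∀ u ∈ R, epsNorm (epsLoc L (splitFormGL L) v) (u : GtLoc L v) = 1)
    (φ : ↥(Subgroup.centralizer ({(γ₀.val : GtLoc L v)} : Set (GtLoc L v))) →* ↥T)
    (hφ : ∀ b : ↥(Subgroup.centralizer ({(γ₀.val : GtLoc L v)} : Set (GtLoc L v))),
      (((φ b : ↥T) : Gqs L v).val : GtLoc L v) = epsNorm (epsLoc L (splitFormGL L) v) (b : GtLoc L v))
    {U' : Set ↥(Subgroup.centralizer ({(γ₀.val : GtLoc L v)} : Set (GtLoc L v)))}
    (F : Set ↥(Subgroup.centralizer ({(γ₀.val : GtLoc L v)} : Set (GtLoc L v))) → ℝ≥0∞) (c : ℝ≥0∞) (tT : Measure ↥T) (f : ↥T → ℝ≥0∞)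
    (h : ∀ B : Set ↥(Subgroup.centralizer ({(γ₀.val : GtLoc L v)} : Set (GtLoc L v))), MeasurableSet B → B ⊆ U' → InjOn φ B →
      F B = c * ∫⁻ p in φ '' B, f p ∂tT) :
    ∀ u ∈ R, ∀ V : Set ↥T, MeasurableSet V → (fun t : ↥T => s t * u) '' V ⊆ U' →
      F ((fun t : ↥T => s t * u) '' V) = c * ∫⁻ t in V, f t ∂tT := by
  intro u hu V hV hVU
  have hid : ∀ t : ↥T, φ (s t * u) = t := fun t => apply_sheet_eq hγ₀ s hsN R hRN φ hφ t hu
  have hinj : InjOn φ ((fun t : ↥T => s t * u) '' V) := by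
    rintro _ ⟨t, -, rfl⟩ _ ⟨t', -, rfl⟩ hEq
    rw [hid, hid] at hEq
    rw [hEq]
  have himg : φ '' ((fun t : ↥T => s t * u) '' V) = V := by
    rw [Set.image_image]
    simp only [hid, Set.image_id']
  rw [h _ (measurableSet_sheet_image hγ₀ hT s hsm hsN R hRN hu hV) hVU hinj, himg]

/-! ## §3 THE LETTER from its rows (hypothesis-first on the per-base-point ROW BUNDLE; `T̃`, `T′` abstracted as `A`, `P′`) -/

variable (L v) in
set_option maxHeartbeats 400000 in  -- one ★ p864907 call with 30 datum-sized arguments (elaboration ≈ 1.5× the default budget)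
/-- **THE TWISTED TUBE JACOBIAN LETTER FROM ITS ROWS** (the (J̃♭-Σ) assembly, S4-R59 (2); HYPOTHESIS-FIRST on the per-base-point ROW BUNDLE `HB`; the socket's
`T̃ = Cent_{G̃_v}(γ₀)` and `T′ = G̃_{δ₀ε}` enter as letters `A`, `P′` — `hAγ : A = Cent(γ₀)`, `P′ ≤ A` closed — so that the statement stays light).  GIVEN — for
every norm homomorphism `φ : A →* T` (`(φ b).val = N b`), every right- and inversion-invariant Haar measure `τA` of `A` and every inversion-invariant Haar measure `ρ`
of `ker φ = T̃ᴺ` — at every point `b₁` of the sheeted transversal a bundle of: chart windows `W j ≤ A` (compact open, antitone, a basis of `𝓝 1`, `ε`-stable), a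
transversal `M₀ ⊆ G̃_v` with mass `m₀`, a start depth `j₀`, the window letters `hA₀m hν hwin₁ hwin₂` (★ p864964 (TJ5-win)), an `A`-neighbourhood `Uloc ∋ b₁` with the
local twisted tube identity `hloc` (W-LOC, [H-loc] MODEL `R90S4TwistedTubeModel`) for a weight `Dloc = cartanWeight ∘ φ` on `Uloc`, and the Herbrand window identity
`hnat` ((TJ6) `R90S4TwistedHerbrandWindow`) — ALL IN THE BYTES OF ★ p864907 `twistedTubeJacobian_of_local` AT THE DATUM `G := G̃_v, ε := ε_v, P := T, tP := tT,
D_P := cartanWeight` — THE LETTER (3′) HOLDS at every `b₁`: ONE call of ★ p864907 (its frame letters discharged here: `A` closed abelian `ε`-stable ★ `R90S4CartanNormMap`,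
`φ` continuous onto with `φ ∘ ε = φ` §1, `τA`∕`ρ` := Haar on the abelian `A`∕`ker φ`), then §2's sheet glue.  «`dδ̃ = D_G(Nδ)² dδ` on the twisted tube.»
[cite: Rogawski1990, §12.5 p. 186; §4.10 pp. 62–64] [cite: HarishChandra1970, Lemma 22] -/
theorem twistedTubeJacobian_of_rows (hv : ∀ w : PlacesOver L v, IsCMField.complexConj L • w.1 = w.1)
    [LocallyCompactSpace (GtLoc L v)] [SecondCountableTopology (GtLoc L v)] [T2Space (GtLoc L v)]
    [MeasurableSpace (Gqs L v)] [BorelSpace (Gqs L v)] [MeasurableSpace (GtLoc L v)] [BorelSpace (GtLoc L v)]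
    (νGt : Measure (GtLoc L v)) [νGt.IsHaarMeasure] [νGt.IsMulRightInvariant]
    {T : Subgroup (Gqs L v)} {γ₀ : Gqs L v} (hγ₀ : IsRegularElt (γ₀.val : GtLoc L v)) (hT : T = Subgroup.centralizer ({γ₀} : Set (Gqs L v)))
    {A : Subgroup (GtLoc L v)} (hAγ : A = Subgroup.centralizer ({(γ₀.val : GtLoc L v)} : Set (GtLoc L v))) (hεA : ∀ x ∈ A, epsLoc L (splitFormGL L) v x ∈ A)
    {P' : Subgroup (GtLoc L v)} (hP'cl : IsClosed (P' : Set (GtLoc L v))) (hP'A : P' ≤ A)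
    (τ' : Measure ↥P') [τ'.IsHaarMeasure] [τ'.IsInvInvariant] [MeasurableSpace (GtLoc L v ⧸ P')] [BorelSpace (GtLoc L v ⧸ P')]
    (Ψ : (GtLoc L v ⧸ P') × ↥A → GtLoc L v) (hΨ : ∀ (x : GtLoc L v) (b : ↥A), Ψ (QuotientGroup.mk x, b) = x * b * (epsLoc L (splitFormGL L) v x)⁻¹)
    (s : ↥T → ↥A) (hsm : Measurable s) (hsN : ∀ t : ↥T, epsNorm (epsLoc L (splitFormGL L) v) (s t : GtLoc L v) = ((t : Gqs L v)).val)
    (R : Finset ↥A) (hRN : ∀ u ∈ R, epsNorm (epsLoc L (splitFormGL L) v) (u : GtLoc L v) = 1)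
    (tT : Measure ↥T) [tT.IsHaarMeasure]
    -- THE ROW BUNDLE at every base point, for every norm homomorphism `φ` and all Haar measures `τA` (on `A`) and `ρ` (on `ker φ`)
    (HB : ∀ (φ : ↥A →* ↥T) (_hφ : ∀ b : ↥A, (((φ b : ↥T) : Gqs L v).val : GtLoc L v) = epsNorm (epsLoc L (splitFormGL L) v) (b : GtLoc L v))
        (τA : Measure ↥A) [τA.IsHaarMeasure] [τA.IsMulRightInvariant] [τA.IsInvInvariant]
        (ρ : Measure ↥φ.ker) [ρ.IsHaarMeasure] [ρ.IsInvInvariant],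
      ∀ b₁ ∈ {b : ↥A | ∃ t : ↥T, IsRegularElt (((t : Gqs L v)).val : GtLoc L v) ∧ ∃ u ∈ R, b = s t * u},
      ∃ (W : ℕ → Subgroup ↥A) (M₀ : Set (GtLoc L v)) (m₀ : ℝ≥0∞) (j₀ : ℕ) (Uloc : Set ↥A) (Dloc : ↥A → ℝ≥0),
        (∀ j, IsOpen (W j : Set ↥A)) ∧ (∀ j, IsCompact (W j : Set ↥A)) ∧ Antitone W ∧ (∀ O ∈ 𝓝 (1 : ↥A), ∃ j, (W j : Set ↥A) ⊆ O) ∧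
        (∀ (j : ℕ) (w : ↥A), w ∈ W j → (⟨epsLoc L (splitFormGL L) v w, hεA w w.2⟩ : ↥A) ∈ W j) ∧
        (∀ j, j₀ ≤ j → MeasurableSet ((QuotientGroup.mk : GtLoc L v → GtLoc L v ⧸ P') '' (M₀ * Subtype.val '' (W j : Set ↥A)))) ∧
        (∀ j, j₀ ≤ j → νGt (M₀ * Subtype.val '' (W j : Set ↥A)) ≠ 0 ∧ νGt (M₀ * Subtype.val '' (W j : Set ↥A)) ≠ ⊤) ∧
        (∀ j, j₀ ≤ j → νGt (M₀ * Subtype.val '' (W j : Set ↥A)) =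
          quotientMeasure P' τ' hP'cl νGt ((QuotientGroup.mk : GtLoc L v → GtLoc L v ⧸ P') '' (M₀ * Subtype.val '' (W j : Set ↥A))) *
            τ' ((Subtype.val : ↥P' → GtLoc L v) ⁻¹' (Subtype.val '' (W j : Set ↥A)))) ∧
        (∀ j, j₀ ≤ j → νGt (M₀ * Subtype.val '' (W j : Set ↥A)) = m₀ * τA (W j : Set ↥A)) ∧
        Uloc ∈ 𝓝 b₁ ∧ (∀ b ∈ Uloc, Dloc b = cartanWeight L v T (φ b)) ∧
        (∀ V' : Set ↥A, MeasurableSet V' → V' ⊆ Uloc →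
          νGt ((fun p : GtLoc L v × ↥A => p.1 * (p.2 : GtLoc L v) * (epsLoc L (splitFormGL L) v p.1)⁻¹) '' (M₀ ×ˢ V')) = m₀ * ∫⁻ b in V', (Dloc b : ℝ≥0∞) ∂τA) ∧
        (∀ j, j₀ ≤ j →
          ρ ((Subtype.val : ↥φ.ker → ↥A) ⁻¹' ((fun w : ↥A => w * (⟨epsLoc L (splitFormGL L) v w, hεA w w.2⟩ : ↥A)⁻¹) '' (W j : Set ↥A))) *
              τ' ((Subtype.val : ↥P' → GtLoc L v) ⁻¹' (Subtype.val '' (W j : Set ↥A))) =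
            ρ ((Subtype.val : ↥φ.ker → ↥A) ⁻¹' (W j : Set ↥A)) * tT (φ '' (W j : Set ↥A)))) :
    ∀ b₁ ∈ {b : ↥A | ∃ t : ↥T, IsRegularElt (((t : Gqs L v)).val : GtLoc L v) ∧ ∃ u ∈ R, b = s t * u},
      ∃ U' : Set ↥A, IsOpen U' ∧ b₁ ∈ U' ∧
      ∃ A₀ : Set (GtLoc L v ⧸ P'), MeasurableSet A₀ ∧ quotientMeasure P' τ' hP'cl νGt A₀ ≠ 0 ∧ quotientMeasure P' τ' hP'cl νGt A₀ ≠ ⊤ ∧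
        ∀ u ∈ R, ∀ V : Set ↥T, MeasurableSet V → V ⊆ {t : ↥T | IsRegularElt (((t : Gqs L v)).val : GtLoc L v)} → (fun t : ↥T => s t * u) '' V ⊆ U' →
          νGt (Ψ '' (A₀ ×ˢ ((fun t : ↥T => s t * u) '' V))) = quotientMeasure P' τ' hP'cl νGt A₀ * ∫⁻ t in V, (cartanWeight L v T t : ℝ≥0∞) ∂tT := by
  intro b₁ hb₁
  have hΦ := splitFormGL_isHermitian L
  subst hAγ
  -- THE FRAME LETTERS of ★ p864907 at the datum
  haveI hA : IsClosed ((Subgroup.centralizer ({(γ₀.val : GtLoc L v)} : Set (GtLoc L v))) : Set (GtLoc L v)) := Set.isClosed_centralizer _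
  haveI : IsClosed (P' : Set (GtLoc L v)) := hP'cl
  have hAc : ∀ x ∈ Subgroup.centralizer ({(γ₀.val : GtLoc L v)} : Set (GtLoc L v)), ∀ y ∈ Subgroup.centralizer ({(γ₀.val : GtLoc L v)} : Set (GtLoc L v)),
      x * y = y * x := fun x hx y hy => mul_comm_of_mem_centralizer_of_isRegularElt hγ₀ hx hy
  have hεc : Continuous (epsLoc L (splitFormGL L) v) := continuous_epsLoc L (splitFormGL L) v
  have hε2 : ∀ δ : GtLoc L v, epsLoc L (splitFormGL L) v (epsLoc L (splitFormGL L) v δ) = δ := fun δ => twistLocal_twistLocal_cm L 3 (splitFormGL L) hΦ v δ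
  -- topology of `T`, `A`, `P′`
  have hTcl : IsClosed (T : Set (Gqs L v)) := by
    rw [hT]; exact Set.isClosed_centralizer _
  haveI : LocallyCompactSpace ↥T := hTcl.locallyCompactSpace
  haveI : LocallyCompactSpace ↥(Subgroup.centralizer ({(γ₀.val : GtLoc L v)} : Set (GtLoc L v))) := hA.locallyCompactSpace
  haveI : LocallyCompactSpace ↥P' := hP'cl.locallyCompactSpace
  -- the norm homomorphism (§1) and `φ ∘ ε = φ`
  obtain ⟨φ, hφc, hφs, hφ⟩ := exists_epsNormHom hγ₀ hT
  have hφε : ∀ w : ↥(Subgroup.centralizer ({(γ₀.val : GtLoc L v)} : Set (GtLoc L v))), φ ⟨epsLoc L (splitFormGL L) v w, hεA w w.2⟩ = φ w := fun w =>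
    Subtype.ext (Subtype.ext (by
      rw [hφ, hφ]
      show epsNorm (epsLoc L (splitFormGL L) v) (epsLoc L (splitFormGL L) v (w : GtLoc L v)) = epsNorm (epsLoc L (splitFormGL L) v) (w : GtLoc L v)
      simp only [epsNorm, hε2]
      exact hAc _ (hεA _ w.2) _ w.2))
  -- Haar measures on the abelian `A` and `ker φ` (right- and inversion-invariant by commutativity; the commutative structure is used only locally)
  have hAcomm : ∀ x y : ↥(Subgroup.centralizer ({(γ₀.val : GtLoc L v)} : Set (GtLoc L v))), x * y = y * x :=
    fun x y => Subtype.ext (hAc _ x.2 _ y.2)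
  haveI hK : IsClosed ((φ.ker : Subgroup ↥(Subgroup.centralizer ({(γ₀.val : GtLoc L v)} : Set (GtLoc L v)))) : Set ↥(Subgroup.centralizer ({(γ₀.val : GtLoc L v)} : Set (GtLoc L v)))) := isClosed_ker φ hφc
  haveI : LocallyCompactSpace ↥φ.ker := hK.locallyCompactSpace
  obtain ⟨τA, _, _, _⟩ := exists_haar_of_comm hAcomm
  obtain ⟨ρ, _, _, _⟩ := exists_haar_of_comm (H := ↥φ.ker) fun x y => Subtype.ext (hAcomm _ _)
  -- s-finiteness of the Haar measures `τ′`, `ρ` on the σ-compact `P′`, `ker φ`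
  haveI : SigmaCompactSpace ↥P' := sigmaCompactSpace_of_locallyCompact_secondCountable
  haveI : SigmaFinite τ' := IsHaarMeasure.sigmaFinite τ'
  haveI : SFinite τ' := instSFiniteOfSigmaFinite
  haveI : SigmaCompactSpace ↥φ.ker := sigmaCompactSpace_of_locallyCompact_secondCountable
  haveI : SigmaFinite ρ := IsHaarMeasure.sigmaFinite ρ
  haveI : SFinite ρ := instSFiniteOfSigmaFinite
  -- THE ROW BUNDLE at `b₁`
  obtain ⟨W, M₀, m₀, j₀, Uloc, Dloc, hWo, hWc, hWanti, hWb, hWε, hA₀m, hν, hwin₁, hwin₂, hUloc, hD, hloc, hnat⟩ :=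
    HB φ hφ τA ρ b₁ hb₁
  -- ONE CALL of ★ p864907 (TJ5-abs)
  obtain ⟨U', hU'o, hb₁U', A₀, hA₀m', hA₀0, hA₀t, hB⟩ :=
    twistedTubeJacobian_of_local (epsLoc L (splitFormGL L) v) (Subgroup.centralizer ({(γ₀.val : GtLoc L v)} : Set (GtLoc L v))) P' φ hP'A hAc hεA hεc hφc hφs hφε
      νGt τA τ' ρ tT W hWo hWc hWanti hWb hWε M₀ m₀ hA₀m hν hwin₁ hwin₂
      (fun p : GtLoc L v × ↥(Subgroup.centralizer ({(γ₀.val : GtLoc L v)} : Set (GtLoc L v))) => p.1 * (p.2 : GtLoc L v) * (epsLoc L (splitFormGL L) v p.1)⁻¹)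
      (fun _ _ => rfl) Ψ hΨ hUloc Dloc (cartanWeight L v T) (measurable_cartanWeight L v hv T) hD hloc hnat
  refine ⟨U', hU'o, hb₁U', A₀, hA₀m', hA₀0, hA₀t, fun u hu V hV _ hVU => ?_⟩
  exact sheet_clause_of_injOn_clause hγ₀ hT s hsm hsN R hRN φ hφ (fun B => νGt (Ψ '' (A₀ ×ˢ B))) _ tT (fun t => (cartanWeight L v T t : ℝ≥0∞))
    (fun B hBm hBU hinj => hB B hBm hinj hBU) u hu V hV hVU

end JacobianOfRows

end Summit.HodgeConjecture.HodgeConjecture.R90.S4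

end
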